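import Literature.Topology.FourManifolds.CollarGerm
import HarnessLib

/-!
# Germs of collar embeddings extend to diffeomorphisms: the construction

Fifth file of the proof of the tree's named fact
`Literature.Topology.FourManifolds.nonempty_diffeomorph_of_isBoundaryGluing` (`Gluing.lean`),
completing `CollarGerm.lean`: for a collar germ `C : CollarGerm n Σ` over a compact manifold
`Σ` without boundary we construct the bijection `S` of the open half cylinder `Σ × (0, ∞)`,
`C^∞` with `C^∞` inverse, equal to `C.Γ` near the bottom and to the identity above a level
`a₁ < C.δ` (`CollarGerm.exists_extension`) — the uniqueness theorem for collars
(Bröcker–Jänich (1982), (13.7); Hirsch (1976), Ch. 8 §1, remark before Thm. 1.9) in germ form.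
See the module docstring of `CollarGerm.lean` for the strategy (`S = S_lev ∘ S_rep`).

## Contents

* `CollarGerm.Frame`: the constants of the construction (bounds `m ≤ ∂ₜheight ≤ Mu` on
  `Σ × (-t₀, t₀)`, the fibrewise inverse `σ` of the height, the level bound `s₁`), and
  `CollarGerm.nonempty_frame`.
* Level maps `Frame.lev u`, `Frame.levInv u` (mutually inverse diffeomorphisms of `Σ` for
  `u ∈ [0, s₁]`, `lev 0 = id`), the cutoff `Frame.tau`, and the level-preserving spread
  `Frame.slev`, `Frame.slevInv`.
* The blend `Frame.bhat` of the height with the identity (`logBlend` of `CollarGerm.lean`), its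
  fibrewise inverse, and the fibre reparametrisation `Frame.srep`, `Frame.srepInv`.
* `CollarGerm.exists_extension`.

Everything here is proved; no named facts are introduced.

## References

* Th. Bröcker, K. Jänich, *Introduction to Differential Topology* (1982), (13.7). [BrockerJanich1982]
* M. W. Hirsch, *Differential Topology* (1976), Ch. 8 §1. [HirschDT1976]
-/

open scoped Manifold ContDiff Topology
open Set Function Metric Filter Topology Real

noncomputable section

namespace Literature.Topology.FourManifolds

/-- Local notation: `𝔼 n` is the model Euclidean space `EuclideanSpace ℝ (Fin n)`. -/
local notation "𝔼 " n:arg => EuclideanSpace ℝ (Fin n)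

namespace CollarGerm

variable {n : ℕ} {S : Type*} [TopologicalSpace S] [ChartedSpace (𝔼 n) S] (C : CollarGerm n S)

/-- **The inverse level map** `k_u y = pr₁ Ψ (y, u)` of a collar germ. [folklore] -/
def levInv (u : ℝ) (y : S) : S := (C.Ψ (y, u)).1

/-! ### The frame of constants -/

/-- **The constants of the construction.** Bounds `m ≤ ∂ₜheight ≤ Mu` on `Σ × (-t₀, t₀)`
(`0 < t₀ < δ`), the fibrewise inverse `σ` of the height there with its properties
(`exists_fibrewise_inverse`), and a level bound `s₁ > 0` (`s₁ ≤ m t₀ / 2`, `s₁ < δ`) below which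
the second component of `Ψ` stays below `t₀`.  Existence: `nonempty_frame`. [folklore] -/
structure Frame (C : CollarGerm n S) where
  /-- Half-width of the zone of derivative bounds. -/
  t₀ : ℝ
  /-- Lower bound of the normal derivative of the height. -/
  m : ℝ
  /-- Upper bound of the normal derivative of the height. -/
  Mu : ℝ
  t₀_pos : 0 < t₀
  t₀_lt : t₀ < C.δ
  m_pos : 0 < m
  m_le : m ≤ Mu
  /-- The derivative bounds. -/
  bound : ∀ x : S, ∀ t ∈ Ioo (-t₀) t₀,
    m ≤ partialT C.height (x, t) ∧ partialT C.height (x, t) ≤ Mu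
  /-- The fibrewise inverse of the height. -/
  σ : S × ℝ → ℝ
  /-- The height is strictly increasing on the fibres. -/
  mono : ∀ x : S, StrictMonoOn (fun t : ℝ => C.height (x, t)) (Ioo (-t₀) t₀)
  /-- `σ` inverts the height on the left. -/
  σ_height : ∀ x : S, ∀ t ∈ Ioo (-t₀) t₀, σ (x, C.height (x, t)) = t
  /-- `σ` inverts the height on the right, on attained values. -/
  σ_spec : ∀ x : S, ∀ s : ℝ, (∃ t ∈ Ioo (-t₀) t₀, C.height (x, t) = s) →
    σ (x, s) ∈ Ioo (-t₀) t₀ ∧ C.height (x, σ (x, s)) = s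
  /-- The set of attained values is open. -/
  isOpen_img : IsOpen {q : S × ℝ | ∃ t ∈ Ioo (-t₀) t₀, C.height (q.1, t) = q.2}
  /-- `σ` is smooth on the attained values. -/
  contMDiffOn_σ : ContMDiffOn ((𝓡 n).prod 𝓘(ℝ, ℝ)) 𝓘(ℝ, ℝ) ∞ σ
    {q : S × ℝ | ∃ t ∈ Ioo (-t₀) t₀, C.height (q.1, t) = q.2}
  /-- The level bound. -/
  s₁ : ℝ
  s₁_pos : 0 < s₁
  s₁_le : s₁ ≤ m * t₀ / 2
  s₁_lt : s₁ < C.δ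
  /-- Below the level bound, `Ψ` stays in the zone of derivative bounds. -/
  Ψ_snd_lt : ∀ y : S, ∀ u ∈ Icc 0 s₁, (C.Ψ (y, u)).2 < t₀

/-- **Frames exist** over a compact nonempty base. [folklore] -/
theorem nonempty_frame [IsManifold (𝓡 n) ∞ S] [CompactSpace S] [Nonempty S] :
    Nonempty C.Frame := by
  obtain ⟨t₀, m, Mu, ht₀, ht₀δ, hm, hmM, hbound⟩ := C.exists_bounds
  obtain ⟨σ, hmono, hσl, hσs, hopen, hσsm⟩ := exists_fibrewise_inverse C.contMDiff_height
    (a := -t₀) (b := t₀) (fun x t ht => hm.trans_le (hbound x t ht).1)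
  obtain ⟨u₁, hu₁, -, hΨ⟩ := exists_forall_mem_of_continuousOn C.δ_pos
    ((continuous_snd.comp_continuousOn C.continuousOn_Ψ)) isOpen_Iio
    (fun y => show (C.Ψ (y, 0)).2 < t₀ by rw [C.Ψ_zero]; exact ht₀)
  refine ⟨{ t₀ := t₀, m := m, Mu := Mu, t₀_pos := ht₀, t₀_lt := ht₀δ, m_pos := hm, m_le := hmM,
            bound := hbound, σ := σ, mono := hmono, σ_height := hσl, σ_spec := hσs,
            isOpen_img := hopen, contMDiffOn_σ := hσsm,
            s₁ := min (u₁ / 2) (min (m * t₀ / 2) (C.δ / 2)),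
            s₁_pos := lt_min (half_pos hu₁) (lt_min (by positivity) (half_pos C.δ_pos)),
            s₁_le := (min_le_right _ _).trans (min_le_left _ _),
            s₁_lt := ((min_le_right _ _).trans (min_le_right _ _)).trans_lt (half_lt_self C.δ_pos),
            Ψ_snd_lt := fun y u hu => hΨ y u ⟨hu.1, ?_⟩ }⟩
  have := min_le_left (u₁ / 2) (min (m * t₀ / 2) (C.δ / 2))
  linarith [hu.2]

namespace Frame

variable {C} (Fr : C.Frame)

/-- `t₀ / 2 < δ`. [folklore] -/
theorem half_t₀_lt : Fr.t₀ / 2 < C.δ := (half_lt_self Fr.t₀_pos).trans Fr.t₀_lt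

/-- **Lower mean value bound**: `m t ≤ height (x, t)` for `t ∈ [0, t₀)`. [folklore] -/
theorem mul_le_height [IsManifold (𝓡 n) ∞ S] (x : S) {t : ℝ} (ht : t ∈ Ico 0 Fr.t₀) :
    Fr.m * t ≤ C.height (x, t) := by
  rcases ht.1.eq_or_lt with rfl | ht0
  · simp [C.height_zero]
  obtain ⟨θ, hθ, heq⟩ := exists_partialT_eq_slope C.contMDiff_height x ht0
  rw [C.height_zero, sub_zero] at heq
  rw [heq]
  have hb := (Fr.bound x θ ⟨by linarith [hθ.1, Fr.t₀_pos], hθ.2.trans ht.2⟩).1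
  nlinarith [ht.1]

/-- **Upper mean value bound**: `height (x, t) ≤ Mu t` for `t ∈ [0, t₀)`. [folklore] -/
theorem height_le_mul [IsManifold (𝓡 n) ∞ S] (x : S) {t : ℝ} (ht : t ∈ Ico 0 Fr.t₀) :
    C.height (x, t) ≤ Fr.Mu * t := by
  rcases ht.1.eq_or_lt with rfl | ht0
  · simp [C.height_zero]
  obtain ⟨θ, hθ, heq⟩ := exists_partialT_eq_slope C.contMDiff_height x ht0
  rw [C.height_zero, sub_zero] at heq
  rw [heq]
  have hb := (Fr.bound x θ ⟨by linarith [hθ.1, Fr.t₀_pos], hθ.2.trans ht.2⟩).2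
  nlinarith [ht.1]

/-- The height is positive on `Σ × (0, t₀)`. [folklore] -/
theorem height_pos [IsManifold (𝓡 n) ∞ S] (x : S) {t : ℝ} (ht : t ∈ Ioo 0 Fr.t₀) :
    0 < C.height (x, t) :=
  (mul_pos Fr.m_pos ht.1).trans_le (Fr.mul_le_height x ⟨ht.1.le, ht.2⟩)

/-- The height is nonpositive on `Σ × (-t₀, 0]`. [folklore] -/
theorem height_nonpos (x : S) {t : ℝ} (ht : t ∈ Ioc (-Fr.t₀) 0) : C.height (x, t) ≤ 0 := by
  rcases ht.2.eq_or_lt with rfl | ht0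
  · rw [C.height_zero]
  · have := Fr.mono x ⟨ht.1, ht.2.trans_lt Fr.t₀_pos⟩ ⟨by linarith [Fr.t₀_pos], Fr.t₀_pos⟩ ht0
    simp only [C.height_zero] at this
    exact this.le

/-- **Small levels are attained** on each fibre, within `[0, t₀/2]`. [folklore] -/
theorem exists_height_eq [IsManifold (𝓡 n) ∞ S] (x : S) {s : ℝ} (hs : s ∈ Icc 0 Fr.s₁) :
    ∃ t ∈ Icc 0 (Fr.t₀ / 2), C.height (x, t) = s := by
  have hcont : ContinuousOn (fun t : ℝ => C.height (x, t)) (Icc 0 (Fr.t₀ / 2)) :=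
    continuousOn_of_forall_continuousAt fun t _ =>
      (hasDerivAt_partialT C.contMDiff_height x t).continuousAt
  have hhalf : Fr.t₀ / 2 ∈ Ico 0 Fr.t₀ := ⟨by linarith [Fr.t₀_pos], half_lt_self Fr.t₀_pos⟩
  have hmem : s ∈ Icc (C.height (x, 0)) (C.height (x, Fr.t₀ / 2)) := by
    rw [C.height_zero]
    refine ⟨hs.1, hs.2.trans (Fr.s₁_le.trans ?_)⟩
    have := Fr.mul_le_height x hhalf
    linarith
  obtain ⟨t, ht, hts⟩ := intermediate_value_Icc (by linarith [Fr.t₀_pos]) hcont hmem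
  exact ⟨t, ht, hts⟩

/-- `(x, s)` is an attained value for `s ∈ [0, s₁]`. [folklore] -/
theorem mem_img [IsManifold (𝓡 n) ∞ S] (x : S) {s : ℝ} (hs : s ∈ Icc 0 Fr.s₁) :
    ∃ t ∈ Ioo (-Fr.t₀) Fr.t₀, C.height (x, t) = s := by
  obtain ⟨t, ht, hts⟩ := Fr.exists_height_eq x hs
  exact ⟨t, ⟨by linarith [ht.1, Fr.t₀_pos], by linarith [ht.2, Fr.t₀_pos]⟩, hts⟩

/-- **The fibrewise inverse on small levels**: `σ (x, s) ∈ [0, t₀/2]` and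
`height (x, σ (x, s)) = s` for `s ∈ [0, s₁]`. [folklore] -/
theorem σ_mem [IsManifold (𝓡 n) ∞ S] (x : S) {s : ℝ} (hs : s ∈ Icc 0 Fr.s₁) :
    Fr.σ (x, s) ∈ Icc 0 (Fr.t₀ / 2) ∧ C.height (x, Fr.σ (x, s)) = s := by
  obtain ⟨t, ht, hts⟩ := Fr.exists_height_eq x hs
  have ht' : t ∈ Ioo (-Fr.t₀) Fr.t₀ := ⟨by linarith [ht.1, Fr.t₀_pos], by linarith [ht.2, Fr.t₀_pos]⟩
  have hσ : Fr.σ (x, s) = t := by rw [← hts]; exact Fr.σ_height x t ht'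
  rw [hσ]
  exact ⟨ht, hts⟩

/-- `σ (x, s) ∈ [0, δ)` for `s ∈ [0, s₁]`. [folklore] -/
theorem σ_mem_Ico [IsManifold (𝓡 n) ∞ S] (x : S) {s : ℝ} (hs : s ∈ Icc 0 Fr.s₁) :
    Fr.σ (x, s) ∈ Ico 0 C.δ :=
  ⟨(Fr.σ_mem x hs).1.1, (Fr.σ_mem x hs).1.2.trans_lt Fr.half_t₀_lt⟩

/-- `σ (x, 0) = 0`. [folklore] -/
theorem σ_zero (x : S) : Fr.σ (x, 0) = 0 := by
  have := Fr.σ_height x 0 ⟨by linarith [Fr.t₀_pos], Fr.t₀_pos⟩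
  rwa [C.height_zero] at this

/-! ### Level maps -/

/-- **The level map** `h_u x = pr₁ Γ (x, σ_x u)` (the level-preserving part of `Γ` at level
`u`). [folklore] -/
def lev (u : ℝ) (x : S) : S := (C.Γ (x, Fr.σ (x, u))).1

/-- `Γ (x, σ_x u) = (h_u x, u)`. [folklore] -/
theorem Γ_σ [IsManifold (𝓡 n) ∞ S] (x : S) {u : ℝ} (hu : u ∈ Icc 0 Fr.s₁) :
    C.Γ (x, Fr.σ (x, u)) = (Fr.lev u x, u) := by
  refine Prod.ext rfl ?_
  show (C.Γ (x, Fr.σ (x, u))).2 = u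
  rw [← C.height_eq x _ (Fr.σ_mem_Ico x hu)]
  exact (Fr.σ_mem x hu).2

/-- `k_u ∘ h_u = id` for `u ∈ [0, s₁]`. [folklore] -/
theorem levInv_lev [IsManifold (𝓡 n) ∞ S] (x : S) {u : ℝ} (hu : u ∈ Icc 0 Fr.s₁) :
    C.levInv u (Fr.lev u x) = x := by
  have h1 := C.Ψ_Γ x (Fr.σ (x, u)) (Fr.σ_mem_Ico x hu)
    (by rw [Fr.Γ_σ x hu]; exact hu.2.trans_lt Fr.s₁_lt)
  rw [Fr.Γ_σ x hu] at h1
  show (C.Ψ (Fr.lev u x, u)).1 = x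
  rw [h1]

/-- The second component of `Ψ` on small levels lies in `[0, t₀) ⊆ [0, δ)`. [folklore] -/
theorem Ψ_snd_mem (y : S) {u : ℝ} (hu : u ∈ Icc 0 Fr.s₁) : (C.Ψ (y, u)).2 ∈ Ico 0 Fr.t₀ :=
  ⟨C.Ψ_snd_nonneg y u ⟨hu.1, hu.2.trans_lt Fr.s₁_lt⟩, Fr.Ψ_snd_lt y u hu⟩

/-- `h_u ∘ k_u = id` for `u ∈ [0, s₁]`. [folklore] -/
theorem lev_levInv [IsManifold (𝓡 n) ∞ S] (y : S) {u : ℝ} (hu : u ∈ Icc 0 Fr.s₁) :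
    Fr.lev u (C.levInv u y) = y := by
  have hu' : u ∈ Ico 0 C.δ := ⟨hu.1, hu.2.trans_lt Fr.s₁_lt⟩
  have hsnd := Fr.Ψ_snd_mem y hu
  have h1 : C.Γ (C.Ψ (y, u)) = (y, u) := C.Γ_Ψ y u hu' (hsnd.2.trans Fr.t₀_lt)
  set x' := (C.Ψ (y, u)).1 with hx'
  set t' := (C.Ψ (y, u)).2 with ht'
  have hq : C.Ψ (y, u) = (x', t') := Prod.ext rfl rfl
  rw [hq] at h1
  have hheight : C.height (x', t') = u := by
    rw [C.height_eq x' t' ⟨hsnd.1, hsnd.2.trans Fr.t₀_lt⟩, h1]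
  have hσ : Fr.σ (x', u) = t' := by
    rw [← hheight]; exact Fr.σ_height x' t' ⟨by linarith [hsnd.1, Fr.t₀_pos], hsnd.2⟩
  show (C.Γ (x', Fr.σ (x', u))).1 = y
  rw [hσ, h1]

/-- `h_0 = id`. [folklore] -/
theorem lev_zero (x : S) : Fr.lev 0 x = x := by
  show (C.Γ (x, Fr.σ (x, 0))).1 = x
  rw [Fr.σ_zero, C.Γ_zero]

/-- **The level cutoff** `τ s = s · χ (2 - 2 s / s₁)`: `τ s = s` for `s ≤ s₁ / 2`, `τ s = 0`
for `s ≥ s₁`, `0 ≤ τ s ≤ s₁` for `s ≥ 0`, smooth. [folklore] -/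
def tau (s : ℝ) : ℝ := s * smoothTransition (2 - 2 * s / Fr.s₁)

/-- `τ s = s` for `s ≤ s₁ / 2`. [folklore] -/
theorem tau_eq_self {s : ℝ} (hs : s ≤ Fr.s₁ / 2) : Fr.tau s = s := by
  rw [tau, smoothTransition.one_of_one_le, mul_one]
  have h := Fr.s₁_pos
  rw [le_sub_iff_add_le, show (1 : ℝ) + 2 * s / Fr.s₁ = 1 + 2 * s / Fr.s₁ from rfl]
  have : 2 * s / Fr.s₁ ≤ 1 := by rw [div_le_one h]; linarith
  linarith

/-- `τ s = 0` for `s ≥ s₁`. [folklore] -/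
theorem tau_eq_zero {s : ℝ} (hs : Fr.s₁ ≤ s) : Fr.tau s = 0 := by
  rw [tau, smoothTransition.zero_of_nonpos, mul_zero]
  have h := Fr.s₁_pos
  have : 2 ≤ 2 * s / Fr.s₁ := by rw [le_div_iff₀ h]; linarith
  linarith

/-- `0 ≤ τ s ≤ s₁` for `s ≥ 0`. [folklore] -/
theorem tau_mem {s : ℝ} (hs : 0 ≤ s) : Fr.tau s ∈ Icc 0 Fr.s₁ := by
  constructor
  · exact mul_nonneg hs (smoothTransition.nonneg _)
  · by_cases h : s ≤ Fr.s₁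
    · calc Fr.tau s ≤ s * 1 := by
            unfold tau; exact mul_le_mul_of_nonneg_left (smoothTransition.le_one _) hs
        _ ≤ Fr.s₁ := by linarith
    · rw [Fr.tau_eq_zero (not_le.1 h).le]; exact Fr.s₁_pos.le

/-- `τ` is smooth. [folklore] -/
theorem contDiff_tau : ContDiff ℝ ∞ Fr.tau := by
  unfold tau
  exact contDiff_id.mul (smoothTransition.contDiff.comp (contDiff_const.sub
    ((contDiff_const.mul contDiff_id).div_const _)))

/-- **The level-preserving spread** `S_lev (x, s) = (h_{τ s} x, s)`. [folklore] -/
def slev (q : S × ℝ) : S × ℝ := (Fr.lev (Fr.tau q.2) q.1, q.2)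

/-- **Its inverse** `(y, s) ↦ (k_{τ s} y, s)`. [folklore] -/
def slevInv (q : S × ℝ) : S × ℝ := (C.levInv (Fr.tau q.2) q.1, q.2)

/-- `S_lev⁻¹ ∘ S_lev = id` on the closed upper half cylinder. [folklore] -/
theorem slevInv_slev [IsManifold (𝓡 n) ∞ S] {q : S × ℝ} (hq : 0 ≤ q.2) :
    Fr.slevInv (Fr.slev q) = q := by
  obtain ⟨x, s⟩ := q
  simp only [slev, slevInv, Fr.levInv_lev x (Fr.tau_mem hq)]

/-- `S_lev ∘ S_lev⁻¹ = id` on the closed upper half cylinder. [folklore] -/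
theorem slev_slevInv [IsManifold (𝓡 n) ∞ S] {q : S × ℝ} (hq : 0 ≤ q.2) :
    Fr.slev (Fr.slevInv q) = q := by
  obtain ⟨y, s⟩ := q
  simp only [slev, slevInv, Fr.lev_levInv y (Fr.tau_mem hq)]

/-- `S_lev` preserves the height (definitional). [folklore] -/
@[simp] theorem slev_snd (q : S × ℝ) : (Fr.slev q).2 = q.2 := rfl

/-- `S_lev⁻¹` preserves the height (definitional). [folklore] -/
@[simp] theorem slevInv_snd (q : S × ℝ) : (Fr.slevInv q).2 = q.2 := rfl

/-- Above the level bound, `S_lev` is the identity. [folklore] -/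
theorem slev_eq_self {q : S × ℝ} (hq : Fr.s₁ ≤ q.2) : Fr.slev q = q := by
  obtain ⟨x, s⟩ := q
  simp only [slev, Fr.tau_eq_zero hq, Fr.lev_zero]

/-- Near the bottom, `S_lev (x, s) = (h_s x, s)`. [folklore] -/
theorem slev_eq_of_le {x : S} {s : ℝ} (hs : s ≤ Fr.s₁ / 2) : Fr.slev (x, s) = (Fr.lev s x, s) := by
  simp only [slev, Fr.tau_eq_self hs]

/-- The map `q ↦ (q.1, σ (q.1, τ q.2))` is smooth on the closed upper half cylinder (indeed
near every point of it). [folklore] -/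
theorem contMDiffAt_sigma_tau [IsManifold (𝓡 n) ∞ S] {q : S × ℝ} (hq : 0 ≤ q.2) :
    ContMDiffAt ((𝓡 n).prod 𝓘(ℝ, ℝ)) ((𝓡 n).prod 𝓘(ℝ, ℝ)) ∞
      (fun q' : S × ℝ => ((q'.1, Fr.σ (q'.1, Fr.tau q'.2)) : S × ℝ)) q := by
  have hτ : ContMDiff 𝓘(ℝ, ℝ) 𝓘(ℝ, ℝ) ∞ Fr.tau := Fr.contDiff_tau.contMDiff
  have hinner : ContMDiff ((𝓡 n).prod 𝓘(ℝ, ℝ)) ((𝓡 n).prod 𝓘(ℝ, ℝ)) ∞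
      fun q' : S × ℝ => ((q'.1, Fr.tau q'.2) : S × ℝ) :=
    contMDiff_fst.prodMk (hτ.comp contMDiff_snd)
  have hmem : ((q.1, Fr.tau q.2) : S × ℝ) ∈
      {q' : S × ℝ | ∃ t ∈ Ioo (-Fr.t₀) Fr.t₀, C.height (q'.1, t) = q'.2} :=
    Fr.mem_img q.1 (Fr.tau_mem hq)
  have hσ : ContMDiffAt ((𝓡 n).prod 𝓘(ℝ, ℝ)) 𝓘(ℝ, ℝ) ∞ Fr.σ (q.1, Fr.tau q.2) :=
    Fr.contMDiffOn_σ.contMDiffAt (Fr.isOpen_img.mem_nhds hmem)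
  exact contMDiffAt_fst.prodMk (hσ.comp q (hinner q))

/-- **`S_lev` is smooth on the open upper half cylinder.** [folklore] -/
theorem contMDiffOn_slev [IsManifold (𝓡 n) ∞ S] : ContMDiffOn ((𝓡 n).prod 𝓘(ℝ, ℝ)) ((𝓡 n).prod 𝓘(ℝ, ℝ)) ∞ Fr.slev
    (univ ×ˢ Ioi 0) := by
  rintro q ⟨-, hq⟩
  have hq' : 0 ≤ q.2 := le_of_lt hq
  have hmaps : MapsTo (fun q' : S × ℝ => ((q'.1, Fr.σ (q'.1, Fr.tau q'.2)) : S × ℝ))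
      (univ ×ˢ Ioi (0 : ℝ)) (univ ×ˢ Ico 0 C.δ) := fun q' hq' =>
    ⟨mem_univ _, Fr.σ_mem_Ico q'.1 (Fr.tau_mem (le_of_lt hq'.2))⟩
  have hΓ : ContMDiffWithinAt ((𝓡 n).prod 𝓘(ℝ, ℝ)) ((𝓡 n).prod 𝓘(ℝ, ℝ)) ∞
      (C.Γ ∘ fun q' : S × ℝ => ((q'.1, Fr.σ (q'.1, Fr.tau q'.2)) : S × ℝ)) (univ ×ˢ Ioi 0) q :=
    (C.contMDiffOn_Γ _ (hmaps ⟨mem_univ _, hq⟩)).comp q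
      (Fr.contMDiffAt_sigma_tau hq').contMDiffWithinAt hmaps
  exact (contMDiffAt_fst.comp_contMDiffWithinAt q hΓ).prodMk contMDiffWithinAt_snd

/-- **`S_lev⁻¹` is smooth on the open upper half cylinder.** [folklore] -/
theorem contMDiffOn_slevInv [IsManifold (𝓡 n) ∞ S] : ContMDiffOn ((𝓡 n).prod 𝓘(ℝ, ℝ)) ((𝓡 n).prod 𝓘(ℝ, ℝ)) ∞ Fr.slevInv
    (univ ×ˢ Ioi 0) := by
  rintro q ⟨-, hq⟩
  have hτ : ContMDiff 𝓘(ℝ, ℝ) 𝓘(ℝ, ℝ) ∞ Fr.tau := Fr.contDiff_tau.contMDiff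
  have hinner : ContMDiff ((𝓡 n).prod 𝓘(ℝ, ℝ)) ((𝓡 n).prod 𝓘(ℝ, ℝ)) ∞
      fun q' : S × ℝ => ((q'.1, Fr.tau q'.2) : S × ℝ) :=
    contMDiff_fst.prodMk (hτ.comp contMDiff_snd)
  have hmaps : MapsTo (fun q' : S × ℝ => ((q'.1, Fr.tau q'.2) : S × ℝ))
      (univ ×ˢ Ioi (0 : ℝ)) (univ ×ˢ Ico 0 C.δ) := fun q' hq' =>
    ⟨mem_univ _, (Fr.tau_mem (le_of_lt hq'.2)).1, (Fr.tau_mem (le_of_lt hq'.2)).2.trans_lt Fr.s₁_lt⟩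
  have hΨ : ContMDiffWithinAt ((𝓡 n).prod 𝓘(ℝ, ℝ)) ((𝓡 n).prod 𝓘(ℝ, ℝ)) ∞
      (C.Ψ ∘ fun q' : S × ℝ => ((q'.1, Fr.tau q'.2) : S × ℝ)) (univ ×ˢ Ioi 0) q :=
    (C.contMDiffOn_Ψ _ (hmaps ⟨mem_univ _, hq⟩)).comp q (hinner q).contMDiffWithinAt hmaps
  exact (contMDiffAt_fst.comp_contMDiffWithinAt q hΨ).prodMk contMDiffWithinAt_snd

/-! ### The blend of the height with the identity -/

/-- `Λ = max |log m| |log Mu|`. [folklore] -/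
def lam : ℝ := max |log Fr.m| |log Fr.Mu|

/-- `μ = min (m / Mu) 1 > 0`. [folklore] -/
def mu : ℝ := min (Fr.m / Fr.Mu) 1

/-- **The scale `L` of the log-slow cutoff**: large enough for the derivative estimate
(`C₀ Λ / L ≤ μ / 2`) and so that `e^{-L} < t₀ / 2`, `e^{-L} < δ / 2`. [folklore] -/
def L : ℝ := 2 * smoothTransitionDerivBound * Fr.lam / Fr.mu + |log (2 / Fr.t₀)| + |log (2 / C.δ)| + 1

/-- `Λ ≥ 0`. [folklore] -/
theorem lam_nonneg : 0 ≤ Fr.lam := le_max_of_le_left (abs_nonneg _)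

/-- `Mu > 0`. [folklore] -/
theorem Mu_pos : 0 < Fr.Mu := Fr.m_pos.trans_le Fr.m_le

/-- `μ > 0`. [folklore] -/
theorem mu_pos : 0 < Fr.mu := lt_min (div_pos Fr.m_pos Fr.Mu_pos) one_pos

/-- The first summand of `L` is nonnegative. [folklore] -/
theorem L_aux_nonneg : 0 ≤ 2 * smoothTransitionDerivBound * Fr.lam / Fr.mu :=
  div_nonneg (mul_nonneg (mul_nonneg two_pos.le smoothTransitionDerivBound_pos.le) Fr.lam_nonneg)
    Fr.mu_pos.le

/-- `L ≥ 1 > 0`. [folklore] -/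
theorem L_pos : 0 < Fr.L := by
  have := Fr.L_aux_nonneg
  have h1 := abs_nonneg (log (2 / Fr.t₀))
  have h2 := abs_nonneg (log (2 / C.δ))
  unfold L; linarith

/-- `e^{-L} < t₀ / 2`. [folklore] -/
theorem exp_neg_L_lt_half_t₀ : exp (-Fr.L) < Fr.t₀ / 2 := by
  have hL : log (2 / Fr.t₀) < Fr.L := by
    have := Fr.L_aux_nonneg
    have h1 := le_abs_self (log (2 / Fr.t₀))
    have h2 := abs_nonneg (log (2 / C.δ))
    unfold L; linarith
  have ht := Fr.t₀_pos
  calc exp (-Fr.L) < exp (-log (2 / Fr.t₀)) := exp_lt_exp.2 (by linarith)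
    _ = Fr.t₀ / 2 := by rw [exp_neg, exp_log (by positivity)]; field_simp

/-- `e^{-L} < δ / 2`. [folklore] -/
theorem exp_neg_L_lt_half_δ : exp (-Fr.L) < C.δ / 2 := by
  have hL : log (2 / C.δ) < Fr.L := by
    have := Fr.L_aux_nonneg
    have h1 := le_abs_self (log (2 / C.δ))
    have h2 := abs_nonneg (log (2 / Fr.t₀))
    unfold L; linarith
  have hδ := C.δ_pos
  calc exp (-Fr.L) < exp (-log (2 / C.δ)) := exp_lt_exp.2 (by linarith)
    _ = C.δ / 2 := by rw [exp_neg, exp_log (by positivity)]; field_simp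

/-- `e^{-L} < t₀`. [folklore] -/
theorem exp_neg_L_lt_t₀ : exp (-Fr.L) < Fr.t₀ := Fr.exp_neg_L_lt_half_t₀.trans (half_lt_self Fr.t₀_pos)

/-- `e^{-2L} < e^{-L}`. [folklore] -/
theorem exp_neg_two_L_lt : exp (-2 * Fr.L) < exp (-Fr.L) := exp_lt_exp.2 (by linarith [Fr.L_pos])

/-- `e^{-2L} < t₀`. [folklore] -/
theorem exp_neg_two_L_lt_t₀ : exp (-2 * Fr.L) < Fr.t₀ := Fr.exp_neg_two_L_lt.trans Fr.exp_neg_L_lt_t₀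

/-- **The largeness condition** `C₀ Λ / L ≤ μ / 2`. [folklore] -/
theorem large : smoothTransitionDerivBound * max |log Fr.m| |log Fr.Mu| / Fr.L ≤
    min (Fr.m / Fr.Mu) 1 / 2 := by
  change smoothTransitionDerivBound * Fr.lam / Fr.L ≤ Fr.mu / 2
  rw [div_le_iff₀ Fr.L_pos]
  have hL : 2 * smoothTransitionDerivBound * Fr.lam / Fr.mu ≤ Fr.L := by
    have h1 := abs_nonneg (log (2 / Fr.t₀))
    have h2 := abs_nonneg (log (2 / C.δ))
    unfold L; linarith
  have hμ := Fr.mu_pos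
  have key : smoothTransitionDerivBound * Fr.lam = Fr.mu / 2 * (2 * smoothTransitionDerivBound * Fr.lam / Fr.mu) := by
    field_simp
  rw [key]
  exact mul_le_mul_of_nonneg_left hL (by positivity)

/-- **The blend of the height along a fibre** `β_x = logBlend L (height (x, ·))`. [folklore] -/
def blend (x : S) : ℝ → ℝ := logBlend Fr.L (fun τ : ℝ => C.height (x, τ))

/-- **The derivative of the blend is positive on `(0, t₀)`.** [folklore] -/
theorem hasDerivAt_blend_pos [IsManifold (𝓡 n) ∞ S] (x : S) {t : ℝ} (ht : t ∈ Ioo 0 Fr.t₀) :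
    ∃ d > 0, HasDerivAt (Fr.blend x) d t := by
  have hpos : 0 < C.height (x, t) := Fr.height_pos x ht
  have hder := hasDerivAt_partialT C.contMDiff_height x t
  refine ⟨_, ?_, hasDerivAt_logBlend (L := Fr.L) ht.1 hpos hder⟩
  refine mul_pos (logBlend_pos _ _ _) (logBlend_deriv_factor_pos (r := fun τ : ℝ => C.height (x, τ))
    (r' := partialT C.height (x, t)) (c₁ := Fr.m) (c₂ := Fr.Mu) (m := Fr.m) Fr.L_pos ht.1 Fr.m_pos
    ?_ ?_ Fr.m_pos (Fr.bound x t ⟨by linarith [ht.1, Fr.t₀_pos], ht.2⟩).1 Fr.large)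
  · rw [le_div_iff₀ ht.1]; exact Fr.mul_le_height x ⟨ht.1.le, ht.2⟩
  · rw [div_le_iff₀ ht.1]; exact Fr.height_le_mul x ⟨ht.1.le, ht.2⟩

/-- Near `0⁺` the blend is the height. [folklore] -/
theorem blend_eq_height [IsManifold (𝓡 n) ∞ S] (x : S) {t : ℝ} (ht : 0 < t) (htL : t ≤ exp (-2 * Fr.L)) :
    Fr.blend x t = C.height (x, t) :=
  logBlend_eq_of_le Fr.L_pos ht htL (Fr.height_pos x ⟨ht, htL.trans_lt Fr.exp_neg_two_L_lt_t₀⟩)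

/-- Above `e^{-L}` the blend is the identity. [folklore] -/
theorem blend_eq_self (x : S) {t : ℝ} (htL : exp (-Fr.L) ≤ t) : Fr.blend x t = t :=
  logBlend_eq_self Fr.L_pos htL

/-- **The global blend** `β̂`: the height below `e^{-2L}`, the blend above (the two agree on
`(0, e^{-2L}]`), a `C^∞` function on the whole cylinder. [folklore] -/
def bhat (q : S × ℝ) : ℝ := if q.2 < exp (-2 * Fr.L) then C.height q else Fr.blend q.1 q.2

/-- On the open upper half cylinder the global blend is the blend. [folklore] -/
theorem bhat_eq_blend [IsManifold (𝓡 n) ∞ S] {q : S × ℝ} (hq : 0 < q.2) : Fr.bhat q = Fr.blend q.1 q.2 := by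
  unfold bhat
  split_ifs with h
  · rw [Fr.blend_eq_height q.1 hq h.le]
  · rfl

/-- Below `e^{-2L}` the global blend is the height. [folklore] -/
theorem bhat_eq_height {q : S × ℝ} (hq : q.2 < exp (-2 * Fr.L)) : Fr.bhat q = C.height q := by
  unfold bhat; rw [if_pos hq]

/-- Above `e^{-L}` the global blend is the height coordinate. [folklore] -/
theorem bhat_eq_self [IsManifold (𝓡 n) ∞ S] {q : S × ℝ} (hq : exp (-Fr.L) ≤ q.2) : Fr.bhat q = q.2 := by
  rw [Fr.bhat_eq_blend ((exp_pos _).trans_le hq), Fr.blend_eq_self q.1 hq]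

/-- The global blend is positive on the open upper half cylinder. [folklore] -/
theorem bhat_pos [IsManifold (𝓡 n) ∞ S] {q : S × ℝ} (hq : 0 < q.2) : 0 < Fr.bhat q := by
  rw [Fr.bhat_eq_blend hq]; exact logBlend_pos _ _ _

/-- **The global blend is `C^∞`.** Three open sets cover the cylinder: `{t < e^{-2L}}` (where
`β̂ = height`), `{e^{-2L}/2 < t < t₀}` (where `β̂` is the smooth formula of `logBlend`, the
height being positive) and `{e^{-L} < t}` (where `β̂ = t`). [folklore] -/
theorem contMDiff_bhat [IsManifold (𝓡 n) ∞ S] : ContMDiff ((𝓡 n).prod 𝓘(ℝ, ℝ)) 𝓘(ℝ, ℝ) ∞ Fr.bhat := by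
  intro q
  have hL := Fr.L_pos
  by_cases h1 : q.2 < exp (-2 * Fr.L)
  · -- `β̂ = height` near `q`
    have hev : Fr.bhat =ᶠ[𝓝 q] C.height := by
      have : {q' : S × ℝ | q'.2 < exp (-2 * Fr.L)} ∈ 𝓝 q :=
        (isOpen_lt continuous_snd continuous_const).mem_nhds h1
      filter_upwards [this] with q' hq'
      exact Fr.bhat_eq_height hq'
    exact (C.contMDiff_height q).congr_of_eventuallyEq hev
  · have hq2 : exp (-2 * Fr.L) / 2 < q.2 := by linarith [not_lt.1 h1, exp_pos (-2 * Fr.L)]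
    have hqpos : 0 < q.2 := (half_pos (exp_pos _)).trans hq2
    by_cases h2 : q.2 < Fr.t₀
    · -- the formula of the blend
      set F : ℝ × ℝ → ℝ := fun p => exp (logCutoff Fr.L p.2 * log p.1 + (1 - logCutoff Fr.L p.2) * log p.2)
        with hF
      have hFd : ContDiffAt ℝ ∞ F (C.height q, q.2) := by
        have hh : C.height q ≠ 0 := by
          have := Fr.height_pos q.1 (t := q.2) ⟨hqpos, h2⟩
          rw [Prod.mk.eta] at this; exact this.ne'
        have ht : q.2 ≠ 0 := hqpos.ne'
        set p₀ : ℝ × ℝ := (C.height q, q.2) with hp₀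
        have hℓ0 : ContDiffAt ℝ ∞ (logCutoff Fr.L) p₀.2 := contDiffAt_logCutoff ht
        have hℓ : ContDiffAt ℝ ∞ (fun p : ℝ × ℝ => logCutoff Fr.L p.2) p₀ := hℓ0.comp p₀ contDiffAt_snd
        have hlog10 : ContDiffAt ℝ ∞ log p₀.1 := contDiffAt_log.2 hh
        have hlog1 : ContDiffAt ℝ ∞ (fun p : ℝ × ℝ => log p.1) p₀ := hlog10.comp p₀ contDiffAt_fst
        have hlog20 : ContDiffAt ℝ ∞ log p₀.2 := contDiffAt_log.2 ht
        have hlog2 : ContDiffAt ℝ ∞ (fun p : ℝ × ℝ => log p.2) p₀ := hlog20.comp p₀ contDiffAt_snd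
        exact ((hℓ.mul hlog1).add ((contDiffAt_const.sub hℓ).mul hlog2)).exp
      have hinner : ContMDiffAt ((𝓡 n).prod 𝓘(ℝ, ℝ)) 𝓘(ℝ, ℝ × ℝ) ∞
          (fun q' : S × ℝ => (C.height q', q'.2)) q :=
        (C.contMDiff_height q).prodMk_space contMDiffAt_snd
      have hcomp := ContDiffAt.comp_contMDiffAt (g := F) (f := fun q' : S × ℝ => (C.height q', q'.2))
        (x := q) hFd hinner
      refine hcomp.congr_of_eventuallyEq ?_
      have : {q' : S × ℝ | exp (-2 * Fr.L) / 2 < q'.2} ∈ 𝓝 q :=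
        (isOpen_lt continuous_const continuous_snd).mem_nhds hq2
      filter_upwards [this] with q' hq'
      have hq'pos : 0 < q'.2 := (half_pos (exp_pos _)).trans hq'
      rw [Fr.bhat_eq_blend hq'pos]
      rfl
    · -- `β̂ = t` near `q`
      have hq3 : exp (-Fr.L) < q.2 := Fr.exp_neg_L_lt_t₀.trans_le (not_lt.1 h2)
      have hev : Fr.bhat =ᶠ[𝓝 q] fun q' => q'.2 := by
        have : {q' : S × ℝ | exp (-Fr.L) < q'.2} ∈ 𝓝 q :=
          (isOpen_lt continuous_const continuous_snd).mem_nhds hq3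
        filter_upwards [this] with q' hq'
        exact Fr.bhat_eq_self hq'.le
      exact contMDiffAt_snd.congr_of_eventuallyEq hev

/-- **The fibres of the global blend have positive derivative** on `(-t₀, ∞)`. [folklore] -/
theorem exists_hasDerivAt_bhat_pos [IsManifold (𝓡 n) ∞ S] (x : S) {t : ℝ} (ht : -Fr.t₀ < t) :
    ∃ d > 0, HasDerivAt (fun τ : ℝ => Fr.bhat (x, τ)) d t := by
  have hL := Fr.L_pos
  by_cases h1 : t < exp (-2 * Fr.L)
  · -- locally the height
    have hev : (fun τ : ℝ => Fr.bhat (x, τ)) =ᶠ[𝓝 t] fun τ => C.height (x, τ) := by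
      filter_upwards [Iio_mem_nhds h1] with τ hτ
      exact Fr.bhat_eq_height (q := (x, τ)) hτ
    refine ⟨partialT C.height (x, t), ?_, (hasDerivAt_partialT C.contMDiff_height x t).congr_of_eventuallyEq hev⟩
    exact Fr.m_pos.trans_le (Fr.bound x t ⟨ht, h1.trans Fr.exp_neg_two_L_lt_t₀⟩).1
  · have hq2 : exp (-2 * Fr.L) / 2 < t := by linarith [not_lt.1 h1, exp_pos (-2 * Fr.L)]
    have hev : (fun τ : ℝ => Fr.bhat (x, τ)) =ᶠ[𝓝 t] Fr.blend x := by
      filter_upwards [Ioi_mem_nhds hq2] with τ hτ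
      exact Fr.bhat_eq_blend (q := (x, τ)) ((half_pos (exp_pos _)).trans hτ)
    by_cases h2 : t < Fr.t₀
    · obtain ⟨d, hd, hder⟩ := Fr.hasDerivAt_blend_pos x ⟨(half_pos (exp_pos _)).trans hq2, h2⟩
      exact ⟨d, hd, hder.congr_of_eventuallyEq hev⟩
    · have hq3 : exp (-Fr.L) < t := Fr.exp_neg_L_lt_t₀.trans_le (not_lt.1 h2)
      have hev' : (fun τ : ℝ => Fr.bhat (x, τ)) =ᶠ[𝓝 t] fun τ => τ := by
        filter_upwards [Ioi_mem_nhds hq3] with τ hτ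
        exact Fr.bhat_eq_self (q := (x, τ)) hτ.le
      exact ⟨1, one_pos, (hasDerivAt_id' t).congr_of_eventuallyEq hev'⟩

/-- The normal derivative of the global blend is positive on `Σ × (-t₀, e^{-L} + 2)`. [folklore] -/
theorem partialT_bhat_pos [IsManifold (𝓡 n) ∞ S] (x : S) {t : ℝ} (ht : t ∈ Ioo (-Fr.t₀) (exp (-Fr.L) + 2)) :
    0 < partialT Fr.bhat (x, t) := by
  obtain ⟨d, hd, hder⟩ := Fr.exists_hasDerivAt_bhat_pos x ht.1
  rw [partialT_apply, hder.deriv]; exact hd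

/-- The fibres of the global blend are continuous on `(-t₀, ∞)`. [folklore] -/
theorem continuousAt_bhat_fibre [IsManifold (𝓡 n) ∞ S] (x : S) {t : ℝ} (ht : -Fr.t₀ < t) :
    ContinuousAt (fun τ : ℝ => Fr.bhat (x, τ)) t := by
  obtain ⟨d, -, hder⟩ := Fr.exists_hasDerivAt_bhat_pos x ht
  exact hder.continuousAt

/-- **Positive levels below `e^{-L} + 1` are attained by the global blend** on every fibre,
within `(-t₀, e^{-L} + 2)` (indeed within `(0, e^{-L} + 1)`). [folklore] -/
theorem exists_bhat_eq [IsManifold (𝓡 n) ∞ S] (x : S) {v : ℝ} (hv : v ∈ Ioo 0 (exp (-Fr.L) + 1)) :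
    ∃ t ∈ Ioo (-Fr.t₀) (exp (-Fr.L) + 2), Fr.bhat (x, t) = v := by
  by_cases h : exp (-Fr.L) ≤ v
  · exact ⟨v, ⟨by linarith [hv.1, Fr.t₀_pos], by linarith [hv.2]⟩, Fr.bhat_eq_self (q := (x, v)) h⟩
  · rw [not_le] at h
    -- intermediate value on `[t₁, e^{-L}]` with `t₁ = min (e^{-2L}/2) (v / (2 Mu))`
    set t₁ := min (exp (-2 * Fr.L) / 2) (v / (2 * Fr.Mu)) with ht₁
    have hMu := Fr.Mu_pos
    have hv0 := hv.1
    have ht₁pos : 0 < t₁ := lt_min (half_pos (exp_pos _)) (by positivity)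
    have ht₁lt : t₁ < exp (-2 * Fr.L) := (min_le_left _ _).trans_lt (half_lt_self (exp_pos _))
    have ht₁le : t₁ ≤ exp (-Fr.L) := (ht₁lt.trans Fr.exp_neg_two_L_lt).le
    have hlow : Fr.bhat (x, t₁) ≤ v := by
      rw [Fr.bhat_eq_height (q := (x, t₁)) ht₁lt]
      have h1 := Fr.height_le_mul x (t := t₁) ⟨ht₁pos.le, ht₁lt.trans Fr.exp_neg_two_L_lt_t₀⟩
      have h2 : Fr.Mu * t₁ ≤ Fr.Mu * (v / (2 * Fr.Mu)) := mul_le_mul_of_nonneg_left (min_le_right _ _) hMu.le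
      have h3 : Fr.Mu * (v / (2 * Fr.Mu)) = v / 2 := by field_simp
      linarith [hv.1]
    have hhigh : v ≤ Fr.bhat (x, exp (-Fr.L)) := by
      rw [Fr.bhat_eq_self (q := (x, exp (-Fr.L))) le_rfl]; exact h.le
    have hcont : ContinuousOn (fun τ : ℝ => Fr.bhat (x, τ)) (Icc t₁ (exp (-Fr.L))) :=
      continuousOn_of_forall_continuousAt fun τ hτ =>
        Fr.continuousAt_bhat_fibre x (by linarith [hτ.1, Fr.t₀_pos])
    obtain ⟨t, ht, htv⟩ := intermediate_value_Icc ht₁le hcont ⟨hlow, hhigh⟩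
    refine ⟨t, ⟨by linarith [ht.1, Fr.t₀_pos], by linarith [ht.2]⟩, htv⟩

/-! ### The fibre reparametrisation -/

/-- **The data of the fibrewise inverse of the global blend** on `Σ × (-t₀, e^{-L} + 2)`
(`exists_fibrewise_inverse`). [folklore] -/
structure BlendInv [IsManifold (𝓡 n) ∞ S] (Fr : C.Frame) where
  /-- The fibrewise inverse. -/
  binv : S × ℝ → ℝ
  /-- Strict monotonicity of the fibres of `β̂`. -/
  mono : ∀ x : S, StrictMonoOn (fun t : ℝ => Fr.bhat (x, t)) (Ioo (-Fr.t₀) (exp (-Fr.L) + 2))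
  /-- Left inverse. -/
  binv_bhat : ∀ x : S, ∀ t ∈ Ioo (-Fr.t₀) (exp (-Fr.L) + 2), binv (x, Fr.bhat (x, t)) = t
  /-- Right inverse on attained values. -/
  spec : ∀ x : S, ∀ s : ℝ, (∃ t ∈ Ioo (-Fr.t₀) (exp (-Fr.L) + 2), Fr.bhat (x, t) = s) →
    binv (x, s) ∈ Ioo (-Fr.t₀) (exp (-Fr.L) + 2) ∧ Fr.bhat (x, binv (x, s)) = s
  /-- The attained values form an open set. -/
  isOpen_img : IsOpen {q : S × ℝ | ∃ t ∈ Ioo (-Fr.t₀) (exp (-Fr.L) + 2), Fr.bhat (q.1, t) = q.2}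
  /-- Smoothness of the inverse. -/
  contMDiffOn_binv : ContMDiffOn ((𝓡 n).prod 𝓘(ℝ, ℝ)) 𝓘(ℝ, ℝ) ∞ binv
    {q : S × ℝ | ∃ t ∈ Ioo (-Fr.t₀) (exp (-Fr.L) + 2), Fr.bhat (q.1, t) = q.2}

/-- The fibrewise inverse of the global blend exists. [folklore] -/
theorem nonempty_blendInv [IsManifold (𝓡 n) ∞ S] : Nonempty Fr.BlendInv := by
  obtain ⟨binv, hmono, hl, hs, ho, hsm⟩ := exists_fibrewise_inverse Fr.contMDiff_bhat
    (a := -Fr.t₀) (b := exp (-Fr.L) + 2) (fun x t ht => Fr.partialT_bhat_pos x ht)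
  exact ⟨⟨binv, hmono, hl, hs, ho, hsm⟩⟩

/-- **The fibre reparametrisation** `S_rep (x, t) = (x, β̂ (x, t))`. [folklore] -/
def srep (q : S × ℝ) : S × ℝ := (q.1, Fr.bhat q)

/-- **Its inverse** `(x, s) ↦ (x, β̂_x⁻¹ s)` (`= (x, s)` above `e^{-L} + 1`). [folklore] -/
def srepInv [IsManifold (𝓡 n) ∞ S] (B : Fr.BlendInv) (q : S × ℝ) : S × ℝ :=
  (q.1, if q.2 < exp (-Fr.L) + 1 then B.binv q else q.2)

section SRep

variable [IsManifold (𝓡 n) ∞ S] (B : Fr.BlendInv)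

/-- `S_rep` is smooth. [folklore] -/
theorem contMDiff_srep : ContMDiff ((𝓡 n).prod 𝓘(ℝ, ℝ)) ((𝓡 n).prod 𝓘(ℝ, ℝ)) ∞ Fr.srep :=
  contMDiff_fst.prodMk Fr.contMDiff_bhat

/-- `S_rep` maps the open upper half cylinder into itself. [folklore] -/
theorem srep_mapsTo : MapsTo Fr.srep (univ ×ˢ Ioi (0 : ℝ)) (univ ×ˢ Ioi (0 : ℝ)) :=
  fun _ hq => ⟨mem_univ _, Fr.bhat_pos hq.2⟩

/-- Positive levels are attained values of `β̂` (for the interval `(-t₀, e^{-L} + 2)`), when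
below `e^{-L} + 1`. [folklore] -/
theorem mem_img_bhat {q : S × ℝ} (hq : q.2 ∈ Ioo 0 (exp (-Fr.L) + 1)) :
    q ∈ {q : S × ℝ | ∃ t ∈ Ioo (-Fr.t₀) (exp (-Fr.L) + 2), Fr.bhat (q.1, t) = q.2} :=
  Fr.exists_bhat_eq q.1 hq

/-- `S_rep⁻¹ ∘ S_rep = id` on the open upper half cylinder. [folklore] -/
theorem srepInv_srep {q : S × ℝ} (hq : 0 < q.2) : Fr.srepInv B (Fr.srep q) = q := by
  obtain ⟨x, t⟩ := q
  simp only [srep, srepInv]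
  refine Prod.ext rfl ?_
  simp only
  split_ifs with h
  · -- `t < e^{-L} + 2`: otherwise `β̂ (x, t) = t ≥ e^{-L} + 1`
    have ht : t ∈ Ioo (-Fr.t₀) (exp (-Fr.L) + 2) := by
      refine ⟨by linarith [Fr.t₀_pos, hq], ?_⟩
      by_contra h'
      rw [not_lt] at h'
      rw [Fr.bhat_eq_self (q := (x, t)) (by simp only; linarith)] at h
      simp only at h
      linarith
    exact B.binv_bhat x t ht
  · -- `β̂ (x, t) ≥ e^{-L} + 1` forces `t ≥ e^{-L}`, hence `β̂ (x, t) = t`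
    rw [not_lt] at h
    by_cases ht : exp (-Fr.L) ≤ t
    · exact Fr.bhat_eq_self (q := (x, t)) ht
    · exfalso
      rw [not_le] at ht
      have hlt := B.mono x ⟨by linarith [Fr.t₀_pos], by linarith⟩
        ⟨by linarith [Fr.t₀_pos, exp_pos (-Fr.L)], by linarith⟩ ht
      simp only at hlt
      rw [Fr.bhat_eq_self (q := (x, exp (-Fr.L))) le_rfl] at hlt
      simp only at hlt h
      linarith

/-- `S_rep ∘ S_rep⁻¹ = id` on the open upper half cylinder. [folklore] -/
theorem srep_srepInv {q : S × ℝ} (hq : 0 < q.2) : Fr.srep (Fr.srepInv B q) = q := by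
  obtain ⟨x, s⟩ := q
  simp only [srep, srepInv]
  refine Prod.ext rfl ?_
  simp only
  split_ifs with h
  · exact (B.spec x s (Fr.exists_bhat_eq x ⟨hq, h⟩)).2
  · exact Fr.bhat_eq_self (q := (x, s)) (by simp only; linarith [not_lt.1 h])

/-- `S_rep⁻¹` maps the open upper half cylinder into itself. [folklore] -/
theorem srepInv_mapsTo : MapsTo (Fr.srepInv B) (univ ×ˢ Ioi (0 : ℝ)) (univ ×ˢ Ioi (0 : ℝ)) := by
  rintro ⟨x, s⟩ ⟨-, hs⟩
  refine ⟨mem_univ _, ?_⟩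
  simp only [srepInv, mem_Ioi]
  split_ifs with h
  · obtain ⟨hmem, hval⟩ := B.spec x s (Fr.exists_bhat_eq x ⟨hs, h⟩)
    by_contra h0
    rw [not_lt] at h0
    have : Fr.bhat (x, B.binv (x, s)) ≤ 0 := by
      rw [Fr.bhat_eq_height (q := (x, B.binv (x, s)))
        (by simp only; exact h0.trans_lt (exp_pos _))]
      exact Fr.height_nonpos x ⟨hmem.1, h0⟩
    rw [hval] at this
    exact absurd hs (not_lt.2 this)
  · linarith [not_lt.1 h, exp_pos (-Fr.L)]

/-- **`S_rep⁻¹` is smooth on the open upper half cylinder.** [folklore] -/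
theorem contMDiffOn_srepInv : ContMDiffOn ((𝓡 n).prod 𝓘(ℝ, ℝ)) ((𝓡 n).prod 𝓘(ℝ, ℝ)) ∞ (Fr.srepInv B)
    (univ ×ˢ Ioi 0) := by
  rintro q ⟨-, hq⟩
  refine ContMDiffAt.contMDiffWithinAt ?_
  refine contMDiffAt_fst.prodMk ?_
  by_cases h : q.2 < exp (-Fr.L) + 1
  · -- locally `binv`
    have hev : (fun q' : S × ℝ => if q'.2 < exp (-Fr.L) + 1 then B.binv q' else q'.2) =ᶠ[𝓝 q] B.binv := by
      have : {q' : S × ℝ | q'.2 < exp (-Fr.L) + 1} ∈ 𝓝 q :=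
        (isOpen_lt continuous_snd continuous_const).mem_nhds h
      filter_upwards [this] with q' hq'
      rw [if_pos hq']
    refine ContMDiffAt.congr_of_eventuallyEq ?_ hev
    exact B.contMDiffOn_binv.contMDiffAt (B.isOpen_img.mem_nhds (Fr.mem_img_bhat ⟨hq, h⟩))
  · -- locally the identity: on `{e^{-L} + 1/2 < t}` both branches give `t`
    have hq' : exp (-Fr.L) + 1 / 2 < q.2 := by linarith [not_lt.1 h]
    have hev : (fun q' : S × ℝ => if q'.2 < exp (-Fr.L) + 1 then B.binv q' else q'.2) =ᶠ[𝓝 q]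
        fun q' => q'.2 := by
      have : {q' : S × ℝ | exp (-Fr.L) + 1 / 2 < q'.2} ∈ 𝓝 q :=
        (isOpen_lt continuous_const continuous_snd).mem_nhds hq'
      filter_upwards [this] with q' hq''
      split_ifs with h'
      · have hself : Fr.bhat (q'.1, q'.2) = q'.2 := Fr.bhat_eq_self (q := (q'.1, q'.2)) (by simp only; linarith)
        have ht : q'.2 ∈ Ioo (-Fr.t₀) (exp (-Fr.L) + 2) := ⟨by linarith [Fr.t₀_pos, exp_pos (-Fr.L)], by linarith⟩
        have := B.binv_bhat q'.1 q'.2 ht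
        rw [hself] at this
        exact this
      · rfl
    exact contMDiffAt_snd.congr_of_eventuallyEq hev

omit [IsManifold (𝓡 n) ∞ S] in
/-- Near the bottom `S_rep (x, t) = (x, height (x, t))`. [folklore] -/
theorem srep_eq_height {q : S × ℝ} (hq : q.2 < exp (-2 * Fr.L)) : Fr.srep q = (q.1, C.height q) := by
  simp only [srep, Fr.bhat_eq_height hq]

/-- Above `e^{-L}`, `S_rep` is the identity. [folklore] -/
theorem srep_eq_self {q : S × ℝ} (hq : exp (-Fr.L) ≤ q.2) : Fr.srep q = q := by
  obtain ⟨x, t⟩ := q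
  simp only [srep, Fr.bhat_eq_self (q := (x, t)) hq]

end SRep

end Frame

/-! ### The extension theorem -/

/-- **Germs of collar embeddings extend to diffeomorphisms (uniqueness of collars, germ form).**
For a collar germ `C` over a compact nonempty manifold `Σ` without boundary there are maps
`S`, `Sinv` of the cylinder and levels `0 < a₂ < a₁ < δ` such that: `S` and `Sinv` are
`C^∞` on the open upper half cylinder `Σ × (0, ∞)`, map it into itself and are mutually
inverse there; `S = C.Γ` on `Σ × (0, a₂]` (where moreover `Γ` stays in the slab
`Σ × [0, δ)`); and `S = id` on `Σ × [a₁, ∞)`.  Thus `S` is a diffeomorphism of `Σ × (0, ∞)`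
with the germ of `Γ` at the bottom and compact support.  Bröcker–Jänich (1982), (13.7) (for
compact `∂M`, two collars are carried into each other on `∂M × [0, ε)` by a diffeotopy fixed
near the complement of a neighbourhood), in the end-map / germ form used by Hirsch (1976),
Ch. 8 §1 (remark before Thm. 1.9) for the smoothing theorem; proved here flow-free as
`S = S_lev ∘ S_rep` (module docstrings of this file and of `CollarGerm.lean`).
[cite: BrockerJanich1982, (13.7)] -/
theorem exists_extension [IsManifold (𝓡 n) ∞ S] [CompactSpace S] [Nonempty S] :
    ∃ (Smap Sinv : S × ℝ → S × ℝ) (a₁ a₂ : ℝ), 0 < a₂ ∧ a₂ < a₁ ∧ a₁ < C.δ ∧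
      ContMDiffOn ((𝓡 n).prod 𝓘(ℝ, ℝ)) ((𝓡 n).prod 𝓘(ℝ, ℝ)) ∞ Smap (univ ×ˢ Ioi 0) ∧
      ContMDiffOn ((𝓡 n).prod 𝓘(ℝ, ℝ)) ((𝓡 n).prod 𝓘(ℝ, ℝ)) ∞ Sinv (univ ×ˢ Ioi 0) ∧
      MapsTo Smap (univ ×ˢ Ioi (0 : ℝ)) (univ ×ˢ Ioi (0 : ℝ)) ∧
      MapsTo Sinv (univ ×ˢ Ioi (0 : ℝ)) (univ ×ˢ Ioi (0 : ℝ)) ∧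
      (∀ q ∈ (univ : Set S) ×ˢ Ioi (0 : ℝ), Sinv (Smap q) = q) ∧
      (∀ q ∈ (univ : Set S) ×ˢ Ioi (0 : ℝ), Smap (Sinv q) = q) ∧
      (∀ q ∈ (univ : Set S) ×ˢ Ioc 0 a₂, Smap q = C.Γ q ∧ C.Γ q ∈ (univ : Set S) ×ˢ Ico 0 C.δ) ∧
      (∀ q ∈ (univ : Set S) ×ˢ Ici a₁, Smap q = q) := by
  obtain ⟨Fr⟩ := C.nonempty_frame
  obtain ⟨B⟩ := Fr.nonempty_blendInv
  have hL := Fr.L_pos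
  have hMu := Fr.Mu_pos
  set a₁ := max (exp (-Fr.L)) Fr.s₁ with ha₁
  set a₂ := min (exp (-2 * Fr.L) / 2) (Fr.s₁ / (4 * Fr.Mu)) with ha₂
  have ha₂pos : 0 < a₂ := lt_min (half_pos (exp_pos _)) (by have := Fr.s₁_pos; positivity)
  have ha₂lt : a₂ < exp (-2 * Fr.L) := (min_le_left _ _).trans_lt (half_lt_self (exp_pos _))
  have ha₂a₁ : a₂ < a₁ := (ha₂lt.trans Fr.exp_neg_two_L_lt).trans_le (le_max_left _ _)
  have ha₁δ : a₁ < C.δ :=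
    max_lt (Fr.exp_neg_L_lt_half_δ.trans (half_lt_self C.δ_pos)) Fr.s₁_lt
  refine ⟨Fr.slev ∘ Fr.srep, Fr.srepInv B ∘ Fr.slevInv, a₁, a₂, ha₂pos, ha₂a₁, ha₁δ,
    ?_, ?_, ?_, ?_, ?_, ?_, ?_, ?_⟩
  · exact Fr.contMDiffOn_slev.comp Fr.contMDiff_srep.contMDiffOn (Fr.srep_mapsTo)
  · refine (Fr.contMDiffOn_srepInv B).comp Fr.contMDiffOn_slevInv fun q hq => ⟨mem_univ _, ?_⟩
    show 0 < (Fr.slevInv q).2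
    rw [Fr.slevInv_snd]; exact hq.2
  · intro q hq
    exact ⟨mem_univ _, by show 0 < (Fr.srep q).2; exact (Fr.srep_mapsTo hq).2⟩
  · intro q hq
    exact Fr.srepInv_mapsTo B ⟨mem_univ _, by rw [Fr.slevInv_snd]; exact hq.2⟩
  · intro q hq
    show Fr.srepInv B (Fr.slevInv (Fr.slev (Fr.srep q))) = q
    rw [Fr.slevInv_slev (le_of_lt (Fr.srep_mapsTo hq).2), Fr.srepInv_srep B hq.2]
  · intro q hq
    show Fr.slev (Fr.srep (Fr.srepInv B (Fr.slevInv q))) = q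
    have h1 : 0 < (Fr.slevInv q).2 := by rw [Fr.slevInv_snd]; exact hq.2
    rw [Fr.srep_srepInv B h1, Fr.slev_slevInv hq.2.le]
  · -- near the bottom: `S = Γ`
    rintro ⟨x, t⟩ ⟨-, ht0, hta⟩
    have htexp : t < exp (-2 * Fr.L) := hta.trans_lt ha₂lt
    have htt₀ : t < Fr.t₀ := htexp.trans Fr.exp_neg_two_L_lt_t₀
    have hheight_le : C.height (x, t) ≤ Fr.s₁ / 2 := by
      have h1 := Fr.height_le_mul x (t := t) ⟨ht0.le, htt₀⟩
      have h2 : Fr.Mu * t ≤ Fr.Mu * (Fr.s₁ / (4 * Fr.Mu)) :=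
        mul_le_mul_of_nonneg_left (hta.trans (min_le_right _ _)) hMu.le
      have h3 : Fr.Mu * (Fr.s₁ / (4 * Fr.Mu)) = Fr.s₁ / 4 := by field_simp
      linarith [Fr.s₁_pos]
    have hheight_nn : 0 ≤ C.height (x, t) := C.height_nonneg x ⟨ht0.le, htt₀.trans Fr.t₀_lt⟩
    have hΓmem : C.Γ (x, t) ∈ (univ : Set S) ×ˢ Ico 0 C.δ := by
      refine ⟨mem_univ _, ?_⟩
      rw [← C.height_eq x t ⟨ht0.le, htt₀.trans Fr.t₀_lt⟩]
      exact ⟨hheight_nn, by linarith [Fr.s₁_lt]⟩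
    refine ⟨?_, hΓmem⟩
    show Fr.slev (Fr.srep (x, t)) = C.Γ (x, t)
    rw [Fr.srep_eq_height (q := (x, t)) htexp, Fr.slev_eq_of_le hheight_le]
    have hσ : Fr.σ (x, C.height (x, t)) = t := Fr.σ_height x t ⟨by linarith [Fr.t₀_pos], htt₀⟩
    refine Prod.ext ?_ ?_
    · show (C.Γ (x, Fr.σ (x, C.height (x, t)))).1 = (C.Γ (x, t)).1
      rw [hσ]
    · show C.height (x, t) = (C.Γ (x, t)).2
      exact C.height_eq x t ⟨ht0.le, htt₀.trans Fr.t₀_lt⟩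
  · -- above `a₁`: `S = id`
    rintro ⟨x, t⟩ ⟨-, hta⟩
    rw [mem_Ici] at hta
    have h1 : exp (-Fr.L) ≤ t := (le_max_left _ _).trans hta
    have h2 : Fr.s₁ ≤ t := (le_max_right _ _).trans hta
    show Fr.slev (Fr.srep (x, t)) = (x, t)
    rw [Fr.srep_eq_self (q := (x, t)) h1, Fr.slev_eq_self (q := (x, t)) h2]

end CollarGerm

end Literature.Topology.FourManifolds
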